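import Summits.Parity.GeneralizedHardyLittlewood.Theorems.BeyondDiagonalBeatsQuarter.OffDiagCoreSplit
import Summits.Parity.GeneralizedHardyLittlewood.Theorems.BeyondDiagonalBeatsQuarter.OffDiagPrincipalShort
import HarnessLib

/-!
# Route `PrimeLevelFamEdge`, crux K_B (stmt-Parity-20343), line `diagonal_kernel_split` rev 4, plan Ω —
# `OffDiagCoreSplit`, part 4 `OffDiagCoreSplitFree`: **the a8 split of the finite dual core, HYPOTHESIS-FREE**

`OffDiagCoreSplit.sum_offDiagCore_eq_coreP_add_coreS_add_coreL_add_coreX` displays the shifted-lattice summability of the box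
transforms for ALL parameters `(d₁, d₂, α, β, c)`; the tree's smoothness lemma `contDiff_uncurry_boxWeight` (hence
`summable_fourier2_intShift`, worker-3/prover-5 `OffDiagPrincipalShort`) only covers `d₁, d₂, α, β ≥ 1` — which is all the
identity ever uses. This file re-runs the cell step with the summability obtained in place and records the identity with NO
hypothesis beyond «prime levels `≥ 40`, `0 < Δ′ ≤ 2`, `R ≥ 1`»:

* `truncDual_eq_cells'` (per cell), `offDiagCore_eq_pieces'` (per level),
  **`sum_offDiagCore_eq_coreP_add_coreS_add_coreL_add_coreX'`** (the block identity, hypothesis-free) —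
  the form L9′ (`offDiagBelowSlack_io_of_pieces`) instantiates.

Finite algebra over landed identities; theorems only; standard axioms. Helper toward `stub_offDiagBelowSlack_io`; closes nothing.
«The programme SEARCHES and TYPES; no claim about Landau–Siegel zeros, Theorems 1–2 of arXiv:2211.02515 or
a repaired Margin232 until a kernel theorem says so.»
-/

noncomputable section

open Finset Polynomial
open scoped Real FourierTransform

namespace Summit.Parity.GeneralizedHardyLittlewood.Theorems.BeyondDiagonalBeatsQuarter.OffDiag

open Literature.NumberTheory.LFunctions Literature.NumberTheory.LFunctions.KMV2000
open Literature.NumberTheory.Sieve.FriedlanderIwaniecPrimes (fourier2)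
open PeterssonSplit (nearBoxes)

section Cell

variable {q : ℕ} [NeZero q]

/-- **One cell of the core is the sum of its four pieces — hypothesis-free form** of
`OffDiagCoreSplit.truncDual_eq_cells`: the shifted-lattice summability of the box transform is DISCHARGED by
`summable_fourier2_intShift` (prover-5/worker-3, `OffDiagPrincipalShort`) and `contDiff_uncurry_boxWeight` (the cell's
parameters `d₁, d₂, l/d₁, m/d₂ ≥ 1`).
[cite: KowalskiMichelVanderKam2000, Lemma 3.3 p. 9, §6 p. 19 — derivation] -/
theorem truncDual_eq_cells' (hq : 40 ≤ q) (hp : q.Prime) {Δ' : ℝ} (h0 : 0 < Δ') (h2 : Δ' ≤ 2) {R : ℕ} (hR : 1 ≤ R)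
    (Hf : ℕ → ℕ → ℕ → ℕ → ℕ → ℕ → ℕ × ℕ → ℕ)
    {r l m d₁ d₂ : ℕ} {i : ℕ × ℕ} (hl : l ∈ Icc 1 ⌊qhat q ^ Δ'⌋₊) (hm : m ∈ Icc 1 ⌊qhat q ^ Δ'⌋₊)
    (hd₁ : d₁ ∈ l.divisors) (hd₂ : d₂ ∈ m.divisors) :
    (∑' h : ℤ × ℤ,
        (if |h.1| ≤ (Hf q d₁ d₂ (l / d₁) (m / d₂) (r + 1) i : ℤ) then
          fourier2 (boxWeight q d₁ d₂ (l / d₁) (m / d₂) (r + 1) i) (h.1 / (q * (r + 1) : ℕ)) (h.2 / (q * (r + 1) : ℕ)) *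
            (dualCount (q * (r + 1)) ((l / d₁ : ℕ) : ZMod (q * (r + 1))) ((m / d₂ : ℕ) : ZMod (q * (r + 1)))
              (h.1 : ZMod (q * (r + 1))) (h.2 : ZMod (q * (r + 1))) : ℂ)
        else 0)) =
      switchedCell (fun c _ s h₁ q ↦ levelPrincipal {q} (fun _ ↦ (1 : ℂ)) (switchMod c s h₁)) Hf q r l m d₁ d₂ i +
        switchedCell (fun c A s h₁ q ↦ levelSmallPart R {q} (fun _ ↦ (1 : ℂ)) (switchMod c s h₁) (switchClass c A s h₁))
          Hf q r l m d₁ d₂ i +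
        switchedCell (fun c A s h₁ q ↦ levelLargePart R {q} (fun _ ↦ (1 : ℂ)) (switchMod c s h₁) (switchClass c A s h₁))
          Hf q r l m d₁ d₂ i +
        unswitchedCell Hf q r l m d₁ d₂ i := by
  classical
  by_cases hcop : Nat.Coprime (l / d₁) (r + 1)
  swap
  · simp only [switchedCell, unswitchedCell, if_neg hcop, zero_add]
  simp only [switchedCell, unswitchedCell, if_pos hcop, add_zero]
  -- the ranges
  have hl1 : 1 ≤ l := (Finset.mem_Icc.mp hl).1
  have hm1 : 1 ≤ m := (Finset.mem_Icc.mp hm).1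
  have hd₁1 : 1 ≤ d₁ := Nat.pos_of_mem_divisors hd₁
  have hd₂1 : 1 ≤ d₂ := Nat.pos_of_mem_divisors hd₂
  have ha1 : 1 ≤ l / d₁ := OffDiagDual.one_le_div_of_dvd (Nat.dvd_of_mem_divisors hd₁) hl1
  have hb1 : 1 ≤ m / d₂ := OffDiagDual.one_le_div_of_dvd (Nat.dvd_of_mem_divisors hd₂) hm1
  have hq2 : 2 ≤ q := by omega
  have hC : 2 ≤ q * (r + 1) := le_trans hq2 (Nat.le_mul_of_pos_right q (Nat.succ_pos r))
  haveI : NeZero (q * (r + 1)) := ⟨by omega⟩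
  have ha : IsUnit (((l / d₁ : ℕ) : ℕ) : ZMod (q * (r + 1))) := isUnit_firstFreq hq hp h0 h2 hl hd₁ hcop
  -- Step 1: the switch (S3)
  rw [tsum_trunc_dual_eq_sum_switch_fourier2 hC ha (m / d₂) _ _ (summable_dual hd₁1 hd₂1 ha1 hb1 i)]
  -- Step 2: per dual modulus
  rw [← Finset.sum_add_distrib, ← Finset.sum_add_distrib]
  refine Finset.sum_congr rfl fun h₁ _ ↦ ?_
  by_cases hu : IsUnit ((h₁ : ℤ) : ZMod (q * (r + 1)))
  swap
  · simp only [if_neg hu, add_zero]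
  simp only [if_pos hu]
  have hh₁ : h₁ ≠ 0 := intCast_ne_zero_of_isUnit hC hu
  -- abbreviations
  set A : ℤ := ((l / d₁ : ℕ) : ℤ) * (m / d₂ : ℕ) with hA
  set Φh : ℤ → ℂ := fun s ↦ fourier2 (boxWeight q d₁ d₂ (l / d₁) (m / d₂) (r + 1) i) (h₁ / (q * (r + 1) : ℕ))
      ((s : ℝ) / h₁ + (((l / d₁ : ℕ) : ℤ) * (m / d₂ : ℕ) : ℝ) / ((h₁ : ℝ) * (q * (r + 1) : ℕ))) with hΦh
  have hΦs : Summable Φh := by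
    have := summable_fourier2_intShift (contDiff_uncurry_boxWeight (q := q) (r := r + 1) hd₁1 hd₂1 ha1 hb1 i)
      (hasCompactSupport_uncurry_boxWeight (q := q) (d₁ := d₁) (d₂ := d₂) (α := l / d₁) (β := m / d₂) (r := r + 1) i)
      hh₁ ((((l / d₁ : ℕ) : ℤ) * (m / d₂ : ℕ) : ℝ) / ((h₁ : ℝ) * (q * (r + 1) : ℕ))) ((h₁ : ℝ) / (q * (r + 1) : ℕ))
    simpa only [hΦh] using this
  -- the three kernel families are summable (kernels bounded by one)
  have hKsum : ∀ (K : ℤ → ℂ), (∀ s, ‖K s‖ ≤ 1) →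
      Summable (fun s : ℤ ↦ if ((switchGcd (r + 1) s h₁ : ℤ) ∣ A ∧ IsUnit (switchClass (r + 1) A s h₁)) then
        K s * Φh s else 0) := by
    intro K hK
    refine Summable.of_norm_bounded hΦs.norm fun s ↦ ?_
    split_ifs
    · rw [norm_mul]
      calc ‖K s‖ * ‖Φh s‖ ≤ 1 * ‖Φh s‖ := mul_le_mul_of_nonneg_right (hK s) (norm_nonneg _)
        _ = ‖Φh s‖ := one_mul _
    · rw [norm_zero]; exact norm_nonneg _
  have hKP := hKsum (fun s ↦ levelPrincipal {q} (fun _ ↦ (1 : ℂ)) (switchMod (r + 1) s h₁)) fun s ↦ by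
    haveI : NeZero (switchMod (r + 1) s h₁) := ⟨switchMod_ne_zero _ s hh₁⟩
    exact (norm_kernels_le R (switchClass (r + 1) A s h₁)).1
  have hKS := hKsum (fun s ↦ levelSmallPart R {q} (fun _ ↦ (1 : ℂ)) (switchMod (r + 1) s h₁)
      (switchClass (r + 1) A s h₁)) fun s ↦ by
    haveI : NeZero (switchMod (r + 1) s h₁) := ⟨switchMod_ne_zero _ s hh₁⟩
    exact (norm_kernels_le R (switchClass (r + 1) A s h₁)).2.1
  have hKL := hKsum (fun s ↦ levelLargePart R {q} (fun _ ↦ (1 : ℂ)) (switchMod (r + 1) s h₁)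
      (switchClass (r + 1) A s h₁)) fun s ↦ by
    haveI : NeZero (switchMod (r + 1) s h₁) := ⟨switchMod_ne_zero _ s hh₁⟩
    exact (norm_kernels_le R (switchClass (r + 1) A s h₁)).2.2
  -- Step 3: pointwise in `s`, the divisor indicator is the sum of the three kernels
  have hpt : ∀ s : ℤ, (if h₁ ∣ ((l / d₁ : ℕ) : ℤ) * (m / d₂ : ℕ) + ((q * (r + 1) : ℕ) : ℤ) * s then Φh s else 0) =
      (if ((switchGcd (r + 1) s h₁ : ℤ) ∣ A ∧ IsUnit (switchClass (r + 1) A s h₁)) then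
          levelPrincipal {q} (fun _ ↦ (1 : ℂ)) (switchMod (r + 1) s h₁) * Φh s else 0) +
      ((if ((switchGcd (r + 1) s h₁ : ℤ) ∣ A ∧ IsUnit (switchClass (r + 1) A s h₁)) then
          levelSmallPart R {q} (fun _ ↦ (1 : ℂ)) (switchMod (r + 1) s h₁) (switchClass (r + 1) A s h₁) * Φh s else 0) +
      (if ((switchGcd (r + 1) s h₁ : ℤ) ∣ A ∧ IsUnit (switchClass (r + 1) A s h₁)) then
          levelLargePart R {q} (fun _ ↦ (1 : ℂ)) (switchMod (r + 1) s h₁) (switchClass (r + 1) A s h₁) * Φh s else 0)) := by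
    intro s
    have hk := ite_dvd_eq_kernels hC hu A s hR
    have e1 : (if h₁ ∣ ((l / d₁ : ℕ) : ℤ) * (m / d₂ : ℕ) + ((q * (r + 1) : ℕ) : ℤ) * s then Φh s else 0) =
        (if h₁ ∣ A + ((q * (r + 1) : ℕ) : ℤ) * s then (1 : ℂ) else 0) * Φh s := by
      rw [hA]; split_ifs <;> simp
    rw [e1, hk]
    split_ifs <;> ring
  have hpt' : ∀ s : ℤ, (if h₁ ∣ ((l / d₁ : ℕ) : ℤ) * (m / d₂ : ℕ) + ((q * (r + 1) : ℕ) : ℤ) * s then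
      fourier2 (boxWeight q d₁ d₂ (l / d₁) (m / d₂) (r + 1) i) (h₁ / (q * (r + 1) : ℕ))
        ((s : ℝ) / h₁ + (((l / d₁ : ℕ) : ℤ) * (m / d₂ : ℕ) : ℝ) / ((h₁ : ℝ) * (q * (r + 1) : ℕ))) else 0) =
      (if ((switchGcd (r + 1) s h₁ : ℤ) ∣ A ∧ IsUnit (switchClass (r + 1) A s h₁)) then
          levelPrincipal {q} (fun _ ↦ (1 : ℂ)) (switchMod (r + 1) s h₁) * Φh s else 0) +
      ((if ((switchGcd (r + 1) s h₁ : ℤ) ∣ A ∧ IsUnit (switchClass (r + 1) A s h₁)) then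
          levelSmallPart R {q} (fun _ ↦ (1 : ℂ)) (switchMod (r + 1) s h₁) (switchClass (r + 1) A s h₁) * Φh s else 0) +
      (if ((switchGcd (r + 1) s h₁ : ℤ) ∣ A ∧ IsUnit (switchClass (r + 1) A s h₁)) then
          levelLargePart R {q} (fun _ ↦ (1 : ℂ)) (switchMod (r + 1) s h₁) (switchClass (r + 1) A s h₁) * Φh s else 0)) :=
    fun s ↦ hpt s
  rw [tsum_congr hpt', (hKP).tsum_add (hKS.add hKL), hKS.tsum_add hKL]
  simp only [hΦh, hA]
  ring

end Cell

/-- **One level: `offDiagCore = P + S + L + X`, hypothesis-free** (`q` prime `≥ 40`, `0 < Δ′ ≤ 2`, `R ≥ 1`, any `Hf`).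
[cite: KowalskiMichelVanderKam2000, §6 p. 19, (21)–(23) p. 12, Lemma 3.3 p. 9 — derivation] -/
theorem offDiagCore_eq_pieces' {q : ℕ} [NeZero q] (hq : 40 ≤ q) (hp : q.Prime) {Δ' : ℝ} (h0 : 0 < Δ') (h2 : Δ' ≤ 2)
    {R : ℕ} (hR : 1 ≤ R) (Hf : ℕ → ℕ → ℕ → ℕ → ℕ → ℕ → ℕ × ℕ → ℕ) :
    offDiagCore Hf Δ' q =
      levelBody q Δ' (switchedCell (fun c _ s h₁ q ↦ levelPrincipal {q} (fun _ ↦ (1 : ℂ)) (switchMod c s h₁)) Hf q) +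
        levelBody q Δ' (switchedCell
          (fun c A s h₁ q ↦ levelSmallPart R {q} (fun _ ↦ (1 : ℂ)) (switchMod c s h₁) (switchClass c A s h₁)) Hf q) +
        levelBody q Δ' (switchedCell
          (fun c A s h₁ q ↦ levelLargePart R {q} (fun _ ↦ (1 : ℂ)) (switchMod c s h₁) (switchClass c A s h₁)) Hf q) +
        levelBody q Δ' (unswitchedCell Hf q) := by
  rw [offDiagCore_eq_levelBody, ← levelBody_add, ← levelBody_add, ← levelBody_add]
  exact levelBody_congr q Δ' fun r _ l hl m hm d₁ hd₁ d₂ hd₂ i _ ↦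
    truncDual_eq_cells' hq hp h0 h2 hR Hf hl hm hd₁ hd₂

/-- **The a8 split of the finite dual core over a block, HYPOTHESIS-FREE**: for a finite set `G` of prime levels `≥ 40`,
`0 < Δ′ ≤ 2`, `R ≥ 1` and any height function `Hf`:
`Σ_{q∈G} offDiagCore Hf Δ′ q = coreP G Hf Δ′ + coreS R G Hf Δ′ + coreL R G Hf Δ′ + coreX G Hf Δ′`.
[cite: KowalskiMichelVanderKam2000, §6 p. 19, (21)–(23) p. 12, Lemma 3.3 p. 9 — derivation; Davenport1980, ch. 29 — derivation] -/
theorem sum_offDiagCore_eq_coreP_add_coreS_add_coreL_add_coreX' (G : Finset ℕ) (hG : ∀ q ∈ G, q.Prime ∧ 40 ≤ q)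
    {Δ' : ℝ} (h0 : 0 < Δ') (h2 : Δ' ≤ 2) {R : ℕ} (hR : 1 ≤ R) (Hf : ℕ → ℕ → ℕ → ℕ → ℕ → ℕ → ℕ × ℕ → ℕ) :
    ∑ q ∈ G, offDiagCore Hf Δ' q = coreP G Hf Δ' + coreS R G Hf Δ' + coreL R G Hf Δ' + coreX G Hf Δ' := by
  unfold coreP coreS coreL coreX coreWith
  rw [← Finset.sum_add_distrib, ← Finset.sum_add_distrib, ← Finset.sum_add_distrib]
  refine Finset.sum_congr rfl fun q hqG ↦ ?_
  obtain ⟨hp, hq⟩ := hG q hqG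
  have hq0 : q ≠ 0 := hp.ne_zero
  haveI : NeZero q := ⟨hq0⟩
  simp only [dif_neg hq0]
  exact offDiagCore_eq_pieces' hq hp h0 h2 hR Hf

/-- **The shifted-lattice summability of the box transforms on the parameters the core uses** (`d₁, d₂, α, β ≥ 1`, any `c`,
`h₁ ≠ 0`) — the `hsum` hypotheses of `OffDiagCoreSplit`/`OffDiagCoreSplitAlgebra` in dischargeable form. [folklore] -/
theorem summable_boxWeight_intShift {q : ℕ} [NeZero q] {d₁ d₂ α β : ℕ} (hd₁ : 1 ≤ d₁) (hd₂ : 1 ≤ d₂) (hα : 1 ≤ α)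
    (hβ : 1 ≤ β) (c : ℕ) (i : ℕ × ℕ) (ξ₁ τ : ℝ) {h₁ : ℤ} (hh₁ : h₁ ≠ 0) :
    Summable (fun s : ℤ ↦ fourier2 (boxWeight q d₁ d₂ α β c i) ξ₁ ((s : ℝ) / h₁ + τ)) :=
  summable_fourier2_intShift (contDiff_uncurry_boxWeight (q := q) (r := c) hd₁ hd₂ hα hβ i)
    (hasCompactSupport_uncurry_boxWeight (q := q) (d₁ := d₁) (d₂ := d₂) (α := α) (β := β) (r := c) i) hh₁ τ ξ₁

end Summit.Parity.GeneralizedHardyLittlewood.Theorems.BeyondDiagonalBeatsQuarter.OffDiag
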